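import Literature.Analysis.FunctionSpaces.BallLipschitzDomain
import Literature.Analysis.FunctionSpaces.ConvexLipschitzDomain
import HarnessLib

/-!
# Exterior domains and shells are Lipschitz domains

Analysis/FunctionSpaces support file (elementary geometry for the accepted notion
`Literature.Analysis.FunctionSpaces.IsLipschitzDomain` of `SobolevTrace.lean`; written for the
Sobolev inequality on the portions `{r₊ < r} ∩ {‖y‖ < R}` of the Kerr–Schild slices — a ball
with the solid horizon ellipsoid removed — in
`Literature/Geometry/Lorentzian/KerrDerivativeDecaySobolev.lean`).

The tree's Sobolev embedding, extension and trace theorems on domains are stated for bounded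
Lipschitz domains `Ω` (Grisvard, *Elliptic problems in nonsmooth domains* (1985), Def. 1.2.1.1:
near every boundary point, inside a ball, `Ω` is the strict epigraph `{γ(P y) < ⟪y, u⟫}` of a
Lipschitz function over the hyperplane `uᗮ`, `P y = y - ⟪y, u⟫ u`), and the tree knows that
balls (`isLipschitzDomain_ball`), bounded convex open sets (`isLipschitzDomain_of_convex`) and
`C^k` domains are Lipschitz domains. This file adds the two closure properties needed to reach
non-convex domains with holes:

* `IsLipschitzGraphNear.outerDomain`, `IsLipschitzDomain.outerDomain`: if `Ω` is a Lipschitz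
  domain then so is its **open exterior** `outerDomain Ω = (closure Ω)ᶜ` — inside the same ball
  it is the strict epigraph of `-γ` in the direction `-u` (Grisvard 1985, §1.2.1: Def. 1.2.1.1
  asks that `Ω` lie "on one side" of the graph; the other side is then the exterior, the graph
  itself being `∂Ω ∩ B`);
* `IsLipschitzDomain.inf`: the intersection of two Lipschitz domains **with disjoint boundaries**
  is a Lipschitz domain (near a boundary point of `Ω₁ ∩ Ω₂` on `∂Ω₁` the set `Ω₂` contains a
  whole ball, in which `Ω₁ ∩ Ω₂ = Ω₁`);
* `isLipschitzDomain_ball_inf_outerDomain`: hence a ball with the closure of a Lipschitz domain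
  `Ω` removed, `B(c, R) ∖ closure Ω` with `closure Ω ⊆ B(c, R)`, is a (bounded) Lipschitz domain —
  in particular the shell between a bounded convex body with nonempty interior and a ball
  containing it (`isLipschitzDomain_ball_inf_outerDomain_of_convex`).

Also recorded: shrinking the ball (`IsLipschitzGraphNear.of_le`) and transport along a local
coincidence of two open sets (`IsLipschitzGraphNear.congr`).

## Mathlib / tree search

Mathlib (this pin) has `frontier_compl`, `frontier_closure_subset`, `frontier_inter_subset`,
`closure_sdiff_frontier`, `Disjoint.closure_right`, `LipschitzWith.neg`, but no notion of Lipschitz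
domain; the tree's `IsLipschitzDomain` API (`SobolevTrace`, `BallLipschitzDomain`,
`ConvexLipschitzDomain`, `LipschitzDomainCover`) has no complement/intersection lemmas
(`lean search 'IsLipschitzDomain\.'`).

## References

* P. Grisvard, *Elliptic problems in nonsmooth domains* (Pitman, 1985), §1.2.1, Def. 1.2.1.1.
* L. C. Evans, *Partial Differential Equations*, 2nd ed. (2010), App. C.1.
-/

noncomputable section

open Set Metric Topology TopologicalSpace
open scoped NNReal InnerProductSpace RealInnerProductSpace

namespace Literature.Analysis.FunctionSpaces

variable {E' : Type*} [NormedAddCommGroup E'] [InnerProductSpace ℝ E']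

/-! ### Elementary operations on local Lipschitz graphs -/

/-- **Shrinking the ball.** If `Ω` is a Lipschitz graph in `B(x, r)` then it is one (with the same
direction and graph function) in every smaller ball `B(x, r')`, `r' ≤ r` (Grisvard 1985,
§1.2.1). [folklore] -/
theorem IsLipschitzGraphNear.of_le {Ω : Opens E'} {x : E'} {r r' : ℝ}
    (h : IsLipschitzGraphNear Ω x r) (hr' : r' ≤ r) : IsLipschitzGraphNear Ω x r' := by
  obtain ⟨u, hu, γ, K, hγ, hΩ⟩ := h
  refine ⟨u, hu, γ, K, hγ, ?_⟩
  ext y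
  constructor
  · rintro ⟨hyΩ, hy⟩
    have hy' : y ∈ (Ω : Set E') ∩ ball x r := ⟨hyΩ, ball_subset_ball hr' hy⟩
    rw [hΩ] at hy'
    exact ⟨hy, hy'.2⟩
  · rintro ⟨hy, hyγ⟩
    have hy' : y ∈ (Ω : Set E') ∩ ball x r := by
      rw [hΩ]
      exact ⟨ball_subset_ball hr' hy, hyγ⟩
    exact ⟨hy'.1, hy⟩

/-- **Transport along a local coincidence.** If two open sets agree inside `B(x, r)` and one is a
Lipschitz graph there, so is the other (the condition only involves `Ω ∩ B(x, r)`). [folklore] -/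
theorem IsLipschitzGraphNear.congr {Ω Ω' : Opens E'} {x : E'} {r : ℝ}
    (h : IsLipschitzGraphNear Ω x r)
    (heq : (Ω' : Set E') ∩ ball x r = (Ω : Set E') ∩ ball x r) :
    IsLipschitzGraphNear Ω' x r := by
  obtain ⟨u, hu, γ, K, hγ, hΩ⟩ := h
  exact ⟨u, hu, γ, K, hγ, heq.trans hΩ⟩

/-! ### The open exterior of an open set -/

/-- The **open exterior** `(closure Ω)ᶜ` of an open set `Ω`, as an open set (for a bounded
domain with a hole `K = closure Ω₀` one writes the domain as `B ⊓ outerDomain Ω₀`). Not to be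
confused with Mathlib's `exterior` (the intersection of all open supersets). [folklore] -/
def outerDomain (Ω : Opens E') : Opens E' :=
  ⟨(closure (Ω : Set E'))ᶜ, isClosed_closure.isOpen_compl⟩

omit [InnerProductSpace ℝ E'] in
/-- Unfolding: the underlying set of `outerDomain Ω` is `(closure Ω)ᶜ`. [folklore] -/
@[simp]
theorem coe_outerDomain (Ω : Opens E') :
    (outerDomain Ω : Set E') = (closure (Ω : Set E'))ᶜ := rfl

omit [InnerProductSpace ℝ E'] in
/-- Membership in the open exterior: `y ∈ outerDomain Ω ↔ y ∉ closure Ω`. [folklore] -/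
theorem mem_outerDomain_iff {Ω : Opens E'} {y : E'} :
    y ∈ outerDomain Ω ↔ y ∉ closure (Ω : Set E') := Iff.rfl

omit [InnerProductSpace ℝ E'] in
/-- The open exterior is disjoint from `Ω`. [folklore] -/
theorem disjoint_outerDomain (Ω : Opens E') : Disjoint (outerDomain Ω : Set E') (Ω : Set E') :=
  Set.disjoint_left.2 fun _ hy hyΩ => hy (subset_closure hyΩ)

omit [InnerProductSpace ℝ E'] in
/-- The boundary of the open exterior is part of the boundary of `Ω`:
`∂((closure Ω)ᶜ) = ∂(closure Ω) ⊆ ∂Ω` (`frontier_compl`, `frontier_closure_subset`). [folklore] -/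
theorem frontier_outerDomain_subset (Ω : Opens E') :
    frontier (outerDomain Ω : Set E') ⊆ frontier (Ω : Set E') := by
  rw [coe_outerDomain, frontier_compl]
  exact frontier_closure_subset

/-- **The exterior of a local Lipschitz graph domain is a local Lipschitz graph domain, in the
same ball.** If `Ω ∩ B(x, r) = {y ∈ B(x, r) | γ(P y) < ⟪y, u⟫}` with `γ` Lipschitz, then
`(closure Ω)ᶜ ∩ B(x, r) = {y ∈ B(x, r) | ⟪y, u⟫ < γ(P y)}`, which is the strict epigraph of `-γ` in
the direction `-u` (same hyperplane, same projection `P`). Indeed the open set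
`{y ∈ B | ⟪y, u⟫ < γ(P y)}` misses `Ω`, hence `closure Ω`; conversely a point of `B ∖ closure Ω`
cannot have `γ(P y) < ⟪y, u⟫` (it would lie in `Ω`) nor `γ(P y) = ⟪y, u⟫` (the points `y + t u`,
`t ↓ 0`, lie in `Ω` and tend to `y`). Grisvard 1985, §1.2.1 (Def. 1.2.1.1: `Ω` lies on one side of
the graph `∂Ω ∩ B`). [cite: Grisvard1985, §1.2.1 (Def. 1.2.1.1)] -/
theorem IsLipschitzGraphNear.outerDomain {Ω : Opens E'} {x : E'} {r : ℝ}
    (h : IsLipschitzGraphNear Ω x r) : IsLipschitzGraphNear (outerDomain Ω) x r := by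
  obtain ⟨u, hu, γ, K, hγ, hΩ⟩ := h
  obtain ⟨P, hP⟩ : ∃ P : E' → E', ∀ y, P y = y - ⟪y, u⟫_ℝ • u := ⟨_, fun y => rfl⟩
  have hPc : Continuous P := continuous_projAlong hP
  have hγc : Continuous γ := hγ.continuous
  -- membership in `Ω` inside the ball
  have hmem : ∀ y ∈ ball x r, y ∈ (Ω : Set E') ↔ γ (P y) < ⟪y, u⟫_ℝ := by
    intro y hy
    constructor
    · intro hyΩ
      have hy' : y ∈ (Ω : Set E') ∩ ball x r := ⟨hyΩ, hy⟩
      rw [hΩ] at hy'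
      rw [hP]
      exact hy'.2
    · intro hlt
      have hy' : y ∈ (Ω : Set E') ∩ ball x r := by
        rw [hΩ]
        rw [hP] at hlt
        exact ⟨hy, hlt⟩
      exact hy'.1
  -- membership in the exterior inside the ball
  have key : ∀ y ∈ ball x r, y ∉ closure (Ω : Set E') ↔ ⟪y, u⟫_ℝ < γ (P y) := by
    intro y hy
    constructor
    · intro hycl
      rcases lt_trichotomy ⟪y, u⟫_ℝ (γ (P y)) with hlt | heq | hgt
      · exact hlt
      · exfalso
        apply hycl
        rw [Metric.mem_closure_iff]
        intro ε hε
        obtain ⟨ρ, hρ, hρball⟩ := Metric.isOpen_iff.1 isOpen_ball y hy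
        set t : ℝ := min (ε / 2) (ρ / 2) with ht_def
        have ht : 0 < t := lt_min (half_pos hε) (half_pos hρ)
        have hnorm : ‖t • u‖ = t := by
          rw [norm_smul, Real.norm_eq_abs, abs_of_pos ht, hu, mul_one]
        refine ⟨y + t • u, ?_, ?_⟩
        · have hyt : y + t • u ∈ ball x r := hρball (by
            rw [mem_ball, dist_eq_norm, add_sub_cancel_left, hnorm]
            exact (min_le_right _ _).trans_lt (half_lt_self hρ))
          refine (hmem _ hyt).2 ?_
          rw [projAlong_add_smul hu hP, inner_add_left, real_inner_smul_left,
            real_inner_self_eq_norm_sq, hu]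
          linarith
        · rw [dist_comm, dist_eq_norm, add_sub_cancel_left, hnorm]
          exact (min_le_left _ _).trans_lt (half_lt_self hε)
      · exact absurd (subset_closure ((hmem y hy).2 hgt)) hycl
    · intro hlt hycl
      have hopen : IsOpen {z | z ∈ ball x r ∧ ⟪z, u⟫_ℝ < γ (P z)} :=
        isOpen_ball.inter (isOpen_lt (continuous_id.inner continuous_const) (hγc.comp hPc))
      have hdisj : Disjoint {z | z ∈ ball x r ∧ ⟪z, u⟫_ℝ < γ (P z)} (Ω : Set E') := by
        rw [Set.disjoint_left]
        rintro z ⟨hz, hzlt⟩ hzΩ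
        exact lt_asymm hzlt ((hmem z hz).1 hzΩ)
      exact Set.disjoint_left.1 (hdisj.closure_right hopen) ⟨hy, hlt⟩ hycl
  refine ⟨-u, by rw [norm_neg, hu], fun w => -γ w, K, hγ.neg, ?_⟩
  ext y
  simp only [coe_outerDomain, mem_inter_iff, mem_compl_iff, mem_setOf_eq, inner_neg_right,
    neg_smul_neg, neg_lt_neg_iff]
  constructor
  · rintro ⟨hcl, hy⟩
    refine ⟨hy, ?_⟩
    rw [← hP]
    exact (key y hy).1 hcl
  · rintro ⟨hy, hlt⟩
    rw [← hP] at hlt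
    exact ⟨(key y hy).2 hlt, hy⟩

/-- **The open exterior of a Lipschitz domain is a Lipschitz domain** (its boundary points are
boundary points of `Ω`, `frontier_outerDomain_subset`, where `IsLipschitzGraphNear.outerDomain`
applies). No boundedness is needed or claimed. Grisvard 1985, §1.2.1. [cite: Grisvard1985, §1.2.1 (Def. 1.2.1.1)] -/
theorem IsLipschitzDomain.outerDomain {Ω : Opens E'} (h : IsLipschitzDomain Ω) :
    IsLipschitzDomain (outerDomain Ω) := by
  intro x hx
  obtain ⟨r, hr, hg⟩ := h x (frontier_outerDomain_subset Ω hx)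
  exact ⟨r, hr, hg.outerDomain⟩

/-! ### Intersections with disjoint boundaries -/

/-- **The intersection of two Lipschitz domains with disjoint boundaries is a Lipschitz domain.**
A boundary point `x` of `Ω₁ ∩ Ω₂` lies in `∂Ω₁ ∩ closure Ω₂` or in `closure Ω₁ ∩ ∂Ω₂`
(`frontier_inter_subset`); in the first case `x ∉ ∂Ω₂`, so `x ∈ Ω₂` and some ball `B(x, ρ) ⊆ Ω₂`,
inside which `Ω₁ ∩ Ω₂ = Ω₁` is a Lipschitz graph (shrink the ball of `Ω₁` at `x` to radius
`≤ ρ`); symmetrically in the second case. (Grisvard 1985, §1.2.1; the hypothesis cannot be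
dropped: two tangent balls.) [folklore] -/
theorem IsLipschitzDomain.inf {Ω₁ Ω₂ : Opens E'} (h₁ : IsLipschitzDomain Ω₁)
    (h₂ : IsLipschitzDomain Ω₂)
    (hdisj : Disjoint (frontier (Ω₁ : Set E')) (frontier (Ω₂ : Set E'))) :
    IsLipschitzDomain (Ω₁ ⊓ Ω₂) := by
  intro x hx
  rw [Opens.coe_inf] at hx
  rcases frontier_inter_subset _ _ hx with ⟨hx₁, hx₂cl⟩ | ⟨hx₁cl, hx₂⟩
  · -- `x ∈ ∂Ω₁ ∩ closure Ω₂`, hence `x ∈ Ω₂`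
    have hxΩ₂ : x ∈ (Ω₂ : Set E') := by
      have hnot : x ∉ frontier (Ω₂ : Set E') := fun h => Set.disjoint_left.1 hdisj hx₁ h
      have hint : x ∈ closure (Ω₂ : Set E') \ frontier (Ω₂ : Set E') := ⟨hx₂cl, hnot⟩
      rw [closure_sdiff_frontier, Ω₂.isOpen.interior_eq] at hint
      exact hint
    obtain ⟨ρ, hρ, hball⟩ := Metric.isOpen_iff.1 Ω₂.isOpen x hxΩ₂
    obtain ⟨r, hr, hg⟩ := h₁ x hx₁
    refine ⟨min r ρ, lt_min hr hρ, (hg.of_le (min_le_left _ _)).congr ?_⟩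
    rw [Opens.coe_inf, inter_assoc,
      inter_eq_right.2 ((ball_subset_ball (min_le_right r ρ)).trans hball)]
  · -- `x ∈ closure Ω₁ ∩ ∂Ω₂`, hence `x ∈ Ω₁`
    have hxΩ₁ : x ∈ (Ω₁ : Set E') := by
      have hnot : x ∉ frontier (Ω₁ : Set E') := fun h => Set.disjoint_left.1 hdisj h hx₂
      have hint : x ∈ closure (Ω₁ : Set E') \ frontier (Ω₁ : Set E') := ⟨hx₁cl, hnot⟩
      rw [closure_sdiff_frontier, Ω₁.isOpen.interior_eq] at hint
      exact hint
    obtain ⟨ρ, hρ, hball⟩ := Metric.isOpen_iff.1 Ω₁.isOpen x hxΩ₁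
    obtain ⟨r, hr, hg⟩ := h₂ x hx₂
    refine ⟨min r ρ, lt_min hr hρ, (hg.of_le (min_le_left _ _)).congr ?_⟩
    rw [Opens.coe_inf, inter_comm (Ω₁ : Set E'), inter_assoc,
      inter_eq_right.2 ((ball_subset_ball (min_le_right r ρ)).trans hball)]

/-! ### Balls with a hole -/

/-- **A ball with the closure of a Lipschitz domain removed is a Lipschitz domain.** For a
Lipschitz domain `Ω` with `closure Ω ⊆ B(c, R)`, the open set `B(c, R) ∩ (closure Ω)ᶜ` is a
Lipschitz domain: `B(c, R)` is one (`isLipschitzDomain_ball`), `(closure Ω)ᶜ` is one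
(`IsLipschitzDomain.outerDomain`), and their boundaries are disjoint since
`∂((closure Ω)ᶜ) ⊆ closure Ω ⊆ B(c, R)` while the open ball misses its own boundary. (Grisvard
1985, §1.2.1; e.g. spherical shells, or a ball minus a smaller closed convex body.) It is bounded
as a subset of the ball. [folklore] -/
theorem isLipschitzDomain_ball_inf_outerDomain {Ω : Opens E'} (hΩ : IsLipschitzDomain Ω)
    {c : E'} {R : ℝ} (hsub : closure (Ω : Set E') ⊆ ball c R) :
    IsLipschitzDomain ((⟨ball c R, isOpen_ball⟩ : Opens E') ⊓ outerDomain Ω) := by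
  refine (isLipschitzDomain_ball c R).inf hΩ.outerDomain ?_
  rw [Set.disjoint_left]
  intro y hyb hyo
  have hyball : y ∈ ball c R :=
    hsub (frontier_subset_closure (frontier_outerDomain_subset Ω hyo))
  have hmem : y ∈ ball c R ∩ frontier (ball c R) := ⟨hyball, hyb⟩
  rw [isOpen_ball.inter_frontier_eq] at hmem
  exact hmem

/-- **The shell between a bounded convex open set and a ball containing its closure is a bounded
Lipschitz domain**: for `Ω` convex, open, bounded with `closure Ω ⊆ B(c, R)`, the open set
`B(c, R) ∩ (closure Ω)ᶜ` is a Lipschitz domain (`isLipschitzDomain_of_convex` and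
`isLipschitzDomain_ball_inf_outerDomain`) — the case of a ball minus a closed solid ellipsoid used
for the Kerr–Schild slices. Agranovich 2015, §9.1 (convex domains are Lipschitz); Grisvard 1985,
§1.2.1. [folklore] -/
theorem isLipschitzDomain_ball_inf_outerDomain_of_convex {Ω : Opens E'}
    (hconv : Convex ℝ (Ω : Set E')) (hbdd : Bornology.IsBounded (Ω : Set E')) {c : E'} {R : ℝ}
    (hsub : closure (Ω : Set E') ⊆ ball c R) :
    IsLipschitzDomain ((⟨ball c R, isOpen_ball⟩ : Opens E') ⊓ outerDomain Ω) :=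
  isLipschitzDomain_ball_inf_outerDomain (isLipschitzDomain_of_convex hconv hbdd) hsub

omit [InnerProductSpace ℝ E'] in
/-- The shell `B(c, R) ∩ (closure Ω)ᶜ` is bounded (it lies in the ball). [folklore] -/
theorem isBounded_ball_inf_outerDomain (Ω : Opens E') (c : E') (R : ℝ) :
    Bornology.IsBounded (((⟨ball c R, isOpen_ball⟩ : Opens E') ⊓ outerDomain Ω : Opens E') :
      Set E') := by
  rw [Opens.coe_inf]
  exact isBounded_ball.subset inter_subset_left

end Literature.Analysis.FunctionSpaces

end
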